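import Mathlib
import Literature.NumberTheory.GaloisRepresentations.StableLatticeValuationRing
import Literature.NumberTheory.GaloisRepresentations.GaloisRep
import Literature.NumberTheory.GaloisRepresentations.SymplecticMultiplier
import Summits.Langlands.Langlands.Theorems.PhantomRMYoshidaResiduallyYoshidaLiftingResidualCharpoly
import Summits.Langlands.Langlands.Theorems.PhantomRMYoshidaResiduallyYoshidaLiftingResidualTriangular
import Summits.Langlands.Langlands.Theorems.PhantomRMYoshidaResiduallyYoshidaLiftingBlockSumConj
import Summits.Langlands.Langlands.Theorems.PhantomRMYoshidaResiduallyYoshidaLiftingSplitFrame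
import HarnessLib

/-!
# Crux `PhantomRMYoshida.ResiduallyYoshidaLifting` (stmt-Langlands-13639), line `endoscopic-crossing-euler`:
# Stub 2 — a `ℤ̄_p`-frame of a residually-Yoshida `ρ : Γ_ℚ → GL₄(ℚ̄_p)` with SPLIT reduction `σ̄ ⊕ σ̄'`

The planner's registered Stub 2 `stub_residualYoshidaSplitting` of the line (statement verbatim below as
`stub_residualYoshidaSplitting`, registered), PROVED from the four landed sub-stubs of the lead's reshape:
`stub_residualCharpoly` (Chebotarev: the a.e. Frobenius factorisation holds at every `g` for the reduction
of an integral model), `stub_residualTriangular` (Brauer–Nesbitt + Burnside descent + dévissage: block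
upper-triangular form over the algebraically closed residue field with irreducible diagonal blocks),
`stub_splitFrame` (the `ϖ`-trick: block-diagonal reduction after conjugating by a lift of the residual basis
and `diag(1,1,ϖ,ϖ)`), `stub_blockSumConj` (Brauer–Nesbitt: the block sum is conjugate to `σ̄ ⊕ σ̄'`), and the
glue facts proved here: any `red : ℤ̄_p → k` (`char k = p`) kills `𝔪_{ℤ̄_p}` and factors through the residue
field, which is algebraically closed; integral models exist over the (non-noetherian) valuation ring `ℤ̄_p`
(`exists_integralModel_of_valuationSubring`).  This is the "entry ticket" to the deformation theory of the
split residual representation that every line at this crux uses; the hypotheses `p ≠ 2`, `IsAlgClosed k`,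
irreducibility of `ρ`, non-conjugacy and the symplectic pairing of the registered statement are not needed
and kept only because the statement is registered verbatim.

References: Serre, *Abelian ℓ-adic representations* (1968) I §1.1, §2.3 [SerreAbelianLadic1968];
Deligne–Serre 1974 §6 [DeligneSerreASENS1974]; Bellaïche–Chenevier 2009 §1.5 [BellaicheChenevier2009].
-/

noncomputable section

open Literature.NumberTheory.GaloisRepresentations

namespace Summit.Langlands.Langlands.Cruxes.ResiduallyYoshidaLifting.EndoscopicCrossingEuler

set_option linter.dupNamespace false

/-! ### Glue facts for the composition: the residue field of `ℤ̄_p` -/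

section ResidueFieldGlue

variable {p : ℕ} [Fact p.Prime]

/-- A non-unit of `ℤ̄_p = 𝒪_{ℚ̄_p}` has norm `< 1`. [folklore] -/
theorem norm_lt_one_of_not_isUnit {x : Valued.integer (PadicAlgCl p)} (hx : ¬ IsUnit x) :
    ‖(x : PadicAlgCl p)‖ < 1 := by
  have h := (Valuation.Integer.not_isUnit_iff_valuation_lt_one (v := Valued.v)).mp hx
  rw [PadicAlgCl.valuation_def] at h
  exact_mod_cast h

/-- Any ring map `red : ℤ̄_p → k` to a field of characteristic `p` kills the elements of norm `< 1`
(`‖x‖^N ≤ ‖p‖`, so `x^N ∈ p ℤ̄_p` and `red(x)^N = 0`).  Re-derived from the crux disprover's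
`red_eq_zero_of_norm_lt_one` (Cruxes/ResiduallyYoshidaLifting/Disproof.lean, not importable). [folklore] -/
theorem red_eq_zero_of_norm_lt_one {k : Type*} [Field k] [CharP k p]
    (red : Valued.integer (PadicAlgCl p) →+* k)
    (x : Valued.integer (PadicAlgCl p)) (hx : ‖(x : PadicAlgCl p)‖ < 1) : red x = 0 := by
  have hp0 : 0 < ‖((p : ℕ) : PadicAlgCl p)‖ :=
    norm_pos_iff.2 (Nat.cast_ne_zero.2 (Fact.out : p.Prime).ne_zero)
  obtain ⟨N, hN⟩ := exists_pow_lt_of_lt_one hp0 hx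
  have hz : ‖(x : PadicAlgCl p) ^ N / (p : PadicAlgCl p)‖ ≤ 1 := by
    rw [norm_div, norm_pow]
    exact (div_le_one hp0).2 hN.le
  have hzmem : (x : PadicAlgCl p) ^ N / (p : PadicAlgCl p) ∈ Valued.integer (PadicAlgCl p) := by
    refine (Valuation.mem_integer_iff _ _).mpr ?_
    rw [PadicAlgCl.valuation_def]
    exact_mod_cast hz
  let z : Valued.integer (PadicAlgCl p) := ⟨_, hzmem⟩
  have hxN : x ^ N = (p : Valued.integer (PadicAlgCl p)) * z := by
    apply Subtype.ext
    change ((x ^ N : Valued.integer (PadicAlgCl p)) : PadicAlgCl p) =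
      ((p : Valued.integer (PadicAlgCl p)) : PadicAlgCl p) *
        ((x : PadicAlgCl p) ^ N / (p : PadicAlgCl p))
    have hp0' : (p : PadicAlgCl p) ≠ 0 := norm_pos_iff.1 hp0
    push_cast
    field_simp
  have h0 : red x ^ N = 0 := by
    rw [← map_pow, hxN, map_mul, map_natCast, CharP.cast_eq_zero, zero_mul]
  exact eq_zero_of_pow_eq_zero h0

/-- Hence `red` kills the maximal ideal of the local ring `ℤ̄_p`. [folklore] -/
theorem red_eq_zero_of_mem_maximalIdeal {k : Type*} [Field k] [CharP k p]
    (red : Valued.integer (PadicAlgCl p) →+* k) {x : Valued.integer (PadicAlgCl p)}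
    (hx : x ∈ IsLocalRing.maximalIdeal (Valued.integer (PadicAlgCl p))) : red x = 0 :=
  red_eq_zero_of_norm_lt_one red x (norm_lt_one_of_not_isUnit hx)

/-- … so `red` is a local homomorphism (it detects units). [folklore] -/
theorem isLocalHom_red {k : Type*} [Field k] [CharP k p]
    (red : Valued.integer (PadicAlgCl p) →+* k) : IsLocalHom red := by
  refine ⟨fun x hx => ?_⟩
  by_contra h
  exact hx.ne_zero (red_eq_zero_of_mem_maximalIdeal red h)

/-- `red` factors through the residue field `ℤ̄_p/𝔪`: `red = f ∘ residue`. [folklore] -/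
theorem exists_residueField_factor {k : Type*} [Field k] [CharP k p]
    (red : Valued.integer (PadicAlgCl p) →+* k) :
    ∃ f : IsLocalRing.ResidueField (Valued.integer (PadicAlgCl p)) →+* k,
      ∀ x, f (IsLocalRing.residue _ x) = red x := by
  haveI := isLocalHom_red red
  exact ⟨IsLocalRing.ResidueField.lift red, fun x => IsLocalRing.ResidueField.lift_residue_apply red x⟩

/-- **The residue field of `ℤ̄_p = 𝒪_{ℚ̄_p}` is algebraically closed**: a monic polynomial over
`ℤ̄_p/𝔪` lifts to a monic polynomial over `ℤ̄_p`, which has a root in the algebraically closed `ℚ̄_p`;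
the root is integral over the valuation ring, hence lies in it, and its residue is a root. [folklore] -/
theorem isAlgClosed_residueField :
    IsAlgClosed (IsLocalRing.ResidueField (Valued.integer (PadicAlgCl p))) := by
  refine IsAlgClosed.of_exists_root _ fun q hq hirr => ?_
  have hsurj : Function.Surjective (IsLocalRing.residue (Valued.integer (PadicAlgCl p))) :=
    Ideal.Quotient.mk_surjective
  obtain ⟨Q, hQ, hdeg, hmonic⟩ :=
    Polynomial.lifts_and_degree_eq_and_monic
      ((Polynomial.mem_lifts q).mpr (Polynomial.map_surjective _ hsurj q)) hq
  have hqdeg : q.degree ≠ 0 := (Polynomial.degree_pos_of_irreducible hirr).ne'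
  set QK : Polynomial (PadicAlgCl p) := Q.map (algebraMap (Valued.integer (PadicAlgCl p)) (PadicAlgCl p))
  have hQKdeg : QK.degree ≠ 0 := by
    rw [hmonic.degree_map, hdeg]
    exact hqdeg
  obtain ⟨α, hα⟩ := IsAlgClosed.exists_root QK hQKdeg
  have hint : IsIntegral (Valued.integer (PadicAlgCl p)) α := by
    refine ⟨Q, hmonic, ?_⟩
    have := hα
    rwa [Polynomial.IsRoot.def, Polynomial.eval_map] at this
  have hαO : α ∈ Valued.integer (PadicAlgCl p) :=
    (Valuation.integer.integers (Valued.v (R := PadicAlgCl p))).mem_of_integral hint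
  refine ⟨IsLocalRing.residue _ ⟨α, hαO⟩, ?_⟩
  have h2 : algebraMap (Valued.integer (PadicAlgCl p)) (PadicAlgCl p) (Q.eval ⟨α, hαO⟩) = QK.eval α := by
    rw [← Polynomial.eval₂_at_apply, ← Polynomial.eval_map]
    rfl
  have h1 : Q.eval ⟨α, hαO⟩ = 0 := by
    have hinj : Function.Injective (algebraMap (Valued.integer (PadicAlgCl p)) (PadicAlgCl p)) :=
      Subtype.val_injective
    apply hinj
    rw [map_zero, h2]
    exact hα
  rw [← hQ, Polynomial.eval_map, Polynomial.eval₂_at_apply, h1, map_zero]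

end ResidueFieldGlue

/-- **Stub 2 of line `endoscopic-crossing-euler` (the planner's registered `stub_residualYoshidaSplitting`,
statement verbatim): a `ℤ̄_p`-integral frame with split residual reduction.**  For `ρ : Γ_ℚ → GL₄(ℚ̄_p)` whose Frobenius polynomials reduce through
`red` to `charpoly σ · charpoly σ'` (`σ, σ'` irreducible): a frame `P` in which `ρ` is `ℤ̄_p`-integral with
BLOCK-DIAGONAL reduction `h (σ ⊕ σ') h⁻¹`, `h ∈ GL₄(k)`.  Proof: integral model over the valuation ring `ℤ̄_p`
(`exists_integralModel_of_valuationSubring`); `red = f ∘ (mod 𝔪)` with `κ = ℤ̄_p/𝔪` algebraically closed; Stub 2a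
gives the characteristic polynomials of the reduction; Stub 2b a residual basis making it block triangular with
irreducible diagonal blocks; Stub 2d a new frame with block diagonal reduction; Stub 2c conjugates the diagonal
blocks (through `f`) to `σ ⊕ σ'`. [cite: BellaicheChenevier2009, §1.5; Ribet1976, Prop. 2.1; SerreAbelianLadic1968, I §1.1] -/
theorem stub_residualYoshidaSplitting :
    ∀ (p : ℕ) [Fact p.Prime], p ≠ 2 → ∀ (k : Type) [Field k] [CharP k p] [IsAlgClosed k]
      [TopologicalSpace k] [DiscreteTopology k] (red : Valued.integer (PadicAlgCl p) →+* k)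
      (σ σ' : Literature.NumberTheory.GaloisRepresentations.FramedGaloisRep ℚ k 2)
      (r : Literature.NumberTheory.GaloisRepresentations.FramedGaloisRep ℚ (PadicAlgCl p) 4),
      let εb : Field.absoluteGaloisGroup ℚ →* (ZMod p)ˣ :=
        (modularCyclotomicCharacter (AlgebraicClosure ℚ)
          (HasEnoughRootsOfUnity.natCard_rootsOfUnity (AlgebraicClosure ℚ) p)).comp
          (MulSemiringAction.toRingAut (Field.absoluteGaloisGroup ℚ) (AlgebraicClosure ℚ))
      σ.toGaloisRep.IsIrreducible → σ'.toGaloisRep.IsIrreducible →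
      (∀ g, Literature.NumberTheory.GaloisRepresentations.FramedRep.det σ g =
          (Units.map (ZMod.castHom (dvd_refl p) k).toMonoidHom (εb g))⁻¹ ∧
        Literature.NumberTheory.GaloisRepresentations.FramedRep.det σ' g =
          Literature.NumberTheory.GaloisRepresentations.FramedRep.det σ g) →
      (¬ ∃ g : GL (Fin 2) k, ∀ x, g * σ x * g⁻¹ = σ' x) →
      r.toGaloisRep.IsIrreducible →
      r.IsSymplecticWithMultiplierFun (fun g => algebraMap ℚ_[p] (PadicAlgCl p)
        ((((Literature.NumberTheory.GaloisRepresentations.GaloisRep.cyclotomicCharacter ℚ p g)⁻¹ :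
          ℤ_[p]ˣ) : ℤ_[p]) : ℚ_[p])) →
      (∀ᶠ v : IsDedekindDomain.HeightOneSpectrum (NumberField.RingOfIntegers ℚ) in Filter.cofinite,
        r.IsUnramifiedAt v ∧ σ.IsUnramifiedAt v ∧ σ'.IsUnramifiedAt v ∧
        ∃ (P : Polynomial (Valued.integer (PadicAlgCl p))) (P₁ P₂ : Polynomial k),
          r.HasFrobCharpolyAt v (P.map (Valued.integer (PadicAlgCl p)).subtype) ∧
          σ.HasFrobCharpolyAt v P₁ ∧ σ'.HasFrobCharpolyAt v P₂ ∧ P.map red = P₁ * P₂) →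
      ∃ (P : GL (Fin 4) (PadicAlgCl p))
        (rint : Field.absoluteGaloisGroup ℚ →* GL (Fin 4) (Valued.integer (PadicAlgCl p)))
        (h : GL (Fin 4) k),
        (∀ g, Matrix.GeneralLinearGroup.map (Valued.integer (PadicAlgCl p)).subtype (rint g) =
          P⁻¹ * r g * P) ∧
        (∀ g, (Matrix.GeneralLinearGroup.map red (rint g)).val =
          h.val * Matrix.reindex finSumFinEquiv finSumFinEquiv
            (Matrix.fromBlocks (σ g).val 0 0 (σ' g).val) * (h⁻¹).val) := by
  intro p _ hp k _ _ _ _ _ red σ σ' r εb hσirr hσ'irr _hdet _hnc _hrirr _hsymp hae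
  classical
  -- (G4) an integral model over the valuation ring `ℤ̄_p` (non-noetherian: Serre's remark, Bézout form)
  obtain ⟨P, rint₀, hP⟩ : ∃ (P : GL (Fin 4) (PadicAlgCl p))
      (rint₀ : Field.absoluteGaloisGroup ℚ →* GL (Fin 4) (Valued.integer (PadicAlgCl p))),
      ∀ g, Matrix.GeneralLinearGroup.map (Valued.integer (PadicAlgCl p)).subtype (rint₀ g) =
        P⁻¹ * r g * P :=
    exists_integralModel_of_valuationSubring (Valued.isOpen_valuationSubring (PadicAlgCl p)) r
  -- (G1) `red = f ∘ residue`, (G2) the residue field `κ` is algebraically closed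
  obtain ⟨f, hf⟩ := exists_residueField_factor red
  haveI : IsAlgClosed (IsLocalRing.ResidueField (Valued.integer (PadicAlgCl p))) :=
    isAlgClosed_residueField
  have hfres : f.comp (IsLocalRing.residue (Valued.integer (PadicAlgCl p))) = red :=
    RingHom.ext hf
  -- Stub 2a: characteristic polynomials of the reduction, for every `g`
  have hchar := stub_residualCharpoly p k red σ σ' r P rint₀ hP hae
  -- the reduction `ρ̄ : Γ_ℚ → GL₄(κ)`
  set ρbar : Field.absoluteGaloisGroup ℚ →* GL (Fin 4) (IsLocalRing.ResidueField (Valued.integer (PadicAlgCl p))) :=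
    (Matrix.GeneralLinearGroup.map (IsLocalRing.residue (Valued.integer (PadicAlgCl p)))).comp rint₀
    with hρbar
  have hρbar_val : ∀ g, (ρbar g).val =
      (rint₀ g).val.map (IsLocalRing.residue (Valued.integer (PadicAlgCl p))) := fun g => rfl
  have hcharbar : ∀ g, ((ρbar g).val.charpoly).map f = (σ g).val.charpoly * (σ' g).val.charpoly := by
    intro g
    rw [hρbar_val, Matrix.charpoly_map, Polynomial.map_map, hfres]
    exact hchar g
  -- Stub 2b: block upper triangular form over `κ`, irreducible diagonal blocks over `k`
  obtain ⟨w, a, d, b, hw, hairr, hdirr⟩ :=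
    stub_residualTriangular (IsLocalRing.ResidueField (Valued.integer (PadicAlgCl p))) k f
      (Field.absoluteGaloisGroup ℚ) ρbar σ.toMonoidHom σ'.toMonoidHom hσirr hσ'irr hcharbar
  -- Stub 2d: a new frame with block DIAGONAL reduction
  obtain ⟨P', rint', hP', hred'⟩ :=
    stub_splitFrame p r P rint₀ w (fun g => (a g).val) (fun g => b g) (fun g => (d g).val) hP hw
  -- Stub 2c: conjugate the diagonal blocks (through `f`) to `σ ⊕ σ'`
  have hmapval : ∀ (u : GL (Fin 2) (IsLocalRing.ResidueField (Valued.integer (PadicAlgCl p)))),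
      (Matrix.GeneralLinearGroup.map f u).val = u.val.map f := fun u => rfl
  have hprod : ∀ g, ((Matrix.GeneralLinearGroup.map f).comp a g).val.charpoly *
      ((Matrix.GeneralLinearGroup.map f).comp d g).val.charpoly =
        (σ.toMonoidHom g).val.charpoly * (σ'.toMonoidHom g).val.charpoly := by
    intro g
    change _ = (σ g).val.charpoly * (σ' g).val.charpoly
    rw [MonoidHom.comp_apply, MonoidHom.comp_apply, hmapval, hmapval, Matrix.charpoly_map,
      Matrix.charpoly_map, ← Polynomial.map_mul, ← hcharbar g]
    congr 1
    have h1 : ((w⁻¹ * ρbar g * w).val).charpoly = (ρbar g).val.charpoly := by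
      rw [Units.val_mul, Units.val_mul, Matrix.coe_units_inv]
      exact Matrix.charpoly_units_conj' w _
    rw [← h1, hw g, Matrix.charpoly_reindex, Matrix.charpoly_fromBlocks_zero₂₁]
  obtain ⟨h, hh⟩ := stub_blockSumConj k (Field.absoluteGaloisGroup ℚ)
    ((Matrix.GeneralLinearGroup.map f).comp a) ((Matrix.GeneralLinearGroup.map f).comp d)
    σ.toMonoidHom σ'.toMonoidHom hairr hdirr hσirr hσ'irr hprod
  refine ⟨P', rint', h, hP', fun g => ?_⟩
  have hred_val : (Matrix.GeneralLinearGroup.map red (rint' g)).val =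
      ((Matrix.GeneralLinearGroup.map (IsLocalRing.residue (Valued.integer (PadicAlgCl p)))
        (rint' g)).val).map f := by
    rw [← hfres]
    rfl
  rw [hred_val, hred' g]
  have hh' := hh g
  rw [MonoidHom.comp_apply, MonoidHom.comp_apply, hmapval, hmapval] at hh'
  have hmap : ∀ M : Matrix (Fin 2 ⊕ Fin 2) (Fin 2 ⊕ Fin 2)
      (IsLocalRing.ResidueField (Valued.integer (PadicAlgCl p))),
      (Matrix.reindex finSumFinEquiv finSumFinEquiv M).map f =
        Matrix.reindex finSumFinEquiv finSumFinEquiv (M.map f) := fun M => rfl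
  rw [hmap, Matrix.fromBlocks_map, Matrix.map_zero _ (map_zero f)]
  exact hh'


end Summit.Langlands.Langlands.Cruxes.ResiduallyYoshidaLifting.EndoscopicCrossingEuler
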